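/-
Copyright (c) 2026 the pub-hodgecm-mathlib formalisation cell (harness21).  Prover seat hodgecm-mathlib-LH4-p15 (g2), req620 Track A «(D-RAM) FOUR-FRAME» squad
(STAGE-1b, row (2) of the piece `f_{T₊}`, the (β₂) road (R-36) «PURE-CELL LEDGER»; β₂ sub-dealer LH4-p04 (g10) WORD #24 ‹TERM.letter.v2› 78b8538f5e7a241e, holder LH4-p15 (g2):
(T-b4) «THE THREE-WAY READ OF A TERMINAL VERTEX»), 2026-09-05.
-/
import Summits.HodgeConjecture.HodgeConjecture.Theorems.F0P3cDyRamRowVertexRayDichotomy        -- ★ p863845 (this seat, T-a): levels `0`/`1` by the ray scalar; the fixed-unit ray from SIZES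
import Summits.HodgeConjecture.HodgeConjecture.Theorems.F0P3cDyRamRowVertexAffineCoordinate    -- ★ p862871 (LH4-p16 (g2)): `rayScalar_eq_affine`
import Summits.HodgeConjecture.HodgeConjecture.Theorems.F0P3cDyRamSmulXPlusLabel              -- ★ (LH4-p13 (g7)): `labelPlus_smul_xPlus_iff_exists_norm`
import Literature.NumberTheory.LocalFields.ValuedCompleteIsAdicComplete                      -- ★ BRIDGE-AC (LH4-p02): `isAdicComplete_valuedInteger_of_completeSpace`
import Literature.NumberTheory.LocalFields.ValuedEmbeddingValueDictionary                    -- ★ Lit: `v_le_uniformizer_of_lt_one` (`|x| < 1 ⇒ |x| ≤ |ϖ|`)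
import HarnessLib

/-!
# Crux `H413`, line LH4 «(D-RAM) FOUR-FRAME» — STAGE-1b, row (2), the (β₂) road (R-36), (ROW-TERM): «THE THREE-WAY READ OF A TERMINAL VERTEX» — on the terminal cell
# `(j, b)` (`j + b = jl`, `2b = m`, `b < j`) a glued vertex `L` over `Λ` is ALWAYS on level `0`; it is OFF level `1` iff its digit `V` has `|α₁ + γ₁V| = 1`; and then its
# `ϖ^{m*}`-value set is `X₊`'s iff `ω(pw·(ϖσϖ)^b)·ω(α₁ + γ₁V) = 1` (LH4-p19 (g2)'s three-way socket ★ p863833: the reads `NX`, `ψ` of (hL₁)(hL₂), per vertex)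

Cell `hodgecm-mathlib` (D-0151), FLOOR 0, crux item H413 = `stmt-HodgeConjecture-24833`, route of record `HCCMUnconditional`; squad F0∕P3c∕LH4; lane
`--supports stmt-HodgeConjecture-24833 --as helper` (count-neutral; pays NO tier-0 row).  THEOREMS ONLY (no `def`, no instance, no notation, no `sorry`, default heartbeats);
★-only imports; states NO law; (β₂) stays a HYPOTHESIS.  Frame = LH4-p16 (g2)'s ★ `…RowVertexAffineSignLabel.valueSet_rowVertex_eq_xPlus_iff_affineSign` (★ p863048's glued-vertex
letters, the `E`-decomposition `μ = jE μ_a + jE μ_b·α`, the glue scalar `pw = ⟨w₀, w₀⟩`, the coordinate `D₀⁻¹(jE pw)⁻¹ = κ₀ + jE(V)·ξ₀`, the reference scalars `R₀, γ₀`) with: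
the ray-domination letters REPLACED by ★ p863845's sizes (`hYb`, `g1 g2 g3`, `jE` isometric); the row sizes at `g ≥ 1` REPLACED by the TERMINAL sizes `|μ_a + μ_b R₀| ≤ |ϖ|^{2b}`,
**`|μ_b γ₀| = |ϖ|^{2b}`** (`g = 0`: the digit term has the size of the main term, so the ray scalar `e₀ = pw·(μ_a + μ_b(R₀ + Vγ₀))` may DROP); the affine dictionary of ★ p864020
`exists_affineLabel_of_coords_depthZero` (both clauses, as `hnx` ∕ `haff`); and the level letters of ★ p863845 §2–§3 (`|u₀₀| ≤ 1`, `|u₀₀ − 1| ≤ |ϖ|`, `|μ| ≤ |ϖE|`,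
`|μ − ρμ| ≤ |cc(α − ρα)|·|ϖE|`, `|μ∕Y| ≤ |ϖE|`, `lam ∈ 𝒪_cc`, the population token); `d` EVEN.
WHY (this seat's (ROW-TERM) plan, squad bus 2026-09-05 00:3x–01:1xZ).  On the terminal cell the shells `(0, m*)`, `(0, m_c)` of ‹TERM.v2›'s two literals are the EXACT LEVEL `0`
(★ `…ShellOfExactLevel` fold); ★ p863845 reads level `0` always, level `1` iff `|e₀| ≤ |ϖ|`, NOT level `1` iff `|e₀| = 1`, and on `|e₀| = 1` the value set is `valueSetMod σ ϖ m* (e′ • X₊)`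
with `|e₀ − e′t₊| ≤ |ϖ|^{m*}`; ★ p862871 writes `e₀ = (pw·P)·(â + b̂·V)`, `P = (ϖσϖ)^b`, `â = (μ_a + μ_b R₀)∕P`, `b̂ = μ_b γ₀∕P` (`|pw·P| = 1`, `|â| ≤ 1`, `|b̂| = 1`); ★ p864020's clause (i)
makes `|e₀| = 1 ⟺ |α₁ + γ₁V| = 1` and clause (ii) reads `ω(e′) = ω(pw·P)·ω(α₁ + γ₁V)`; ★ `labelPlus_smul_xPlus_iff_exists_norm` turns `ω(e′) = 1` into the literal.  So, per vertex:
**level `0`; `¬` level `1` ⟺ `NX(V) :≡ |α₁ + γ₁V| = 1`; and under `NX(V)`: `VS_{m*} = VS_{m*}(X₊) ⟺ ω(pw·P)·ω(α₁ + γ₁V) = 1`** — the per-vertex half of the reads (hL₁)(hL₂) of ★ p863833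
for ‹TERM.v2› (the constancy `ω(pw·P) = ω(−h_W)` on populated vertices is LH4-p16's ★ `weight_ne_zero_iff_normSign_pairing_of_gen`; the digit transfer to the given generator is ★ p863952).
* HEAD `level_and_label_of_terminalVertex` (the step `|x| < 1 → |x| ≤ |ϖ|` is ★ Lit `v_le_uniformizer_of_lt_one`).
WHAT IS NOT CLAIMED: the instance for ‹TERM.v2› (the socket assembly), the digit system, any count, any census identity.
HONEST LABEL.  Count-neutral valuation ∕ lattice algebra; nothing printed is asserted; no census law is stated; ‹TERM.v2› stays OPEN; `HC_CM` is proved only modulo the 7 printed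
citations (2 remaining named inputs: hLiu418 = `stmt-HodgeConjecture-24832`, h413 = `stmt-HodgeConjecture-24833`) until rung 0 closes.
## References
* [Jacobowitz1962] R. Jacobowitz, *Hermitian forms over local fields*, Amer. J. Math. 84 (1962): §4 (dual lattices, gluing, the glue unit).
* [Kottwitz1986BaseChangeUnits] R. E. Kottwitz, *Base change for unit elements of Hecke algebras*, Compositio Math. 60 (1986): §1 pp. 240–241, §3.
* [Rogawski1990] J. D. Rogawski, *Automorphic Representations of Unitary Groups in Three Variables*, Ann. of Math. Stud. 123 (1990): §4.9 Prop. 4.9.1 (b) p. 55, §12.2.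
* [Serre1979] J.-P. Serre, *Local Fields*, GTM 67 (1979): Ch. III §6 Prop. 12, Ch. V §3 Cor. 3 pp. 84–86, Ch. XV §2 (norm classes).
-/

set_option autoImplicit false

noncomputable section

namespace Summit.HodgeConjecture.HodgeConjecture.Cruxes.H413.F0P3cDyRamTerminalVertexRead

open scoped Valued WithZero Matrix MatrixGroups
open WithZero
open Literature.NumberTheory.Automorphic Literature.NumberTheory.Automorphic.HermitianLattice Literature.NumberTheory.Automorphic.UnitaryLatticeTree
open Literature.NumberTheory.Automorphic.UnitaryThreeFourFrame (IsRamifiedQuadraticDatum normSign)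
open Literature.NumberTheory.Rogawski1990
open Literature.NumberTheory.LocalFields (isAdicComplete_valuedInteger_of_completeSpace)
open Literature.NumberTheory.LocalFields.ValuedEmbedding (v_le_uniformizer_of_lt_one)
open Summit.HodgeConjecture.HodgeConjecture.Cruxes.H413.F0P3cDyRamFourFramePieces
open Summit.HodgeConjecture.HodgeConjecture.Cruxes.H413.F0P3cDyRamFourFrameCensusDefs (LatticeInLevel)
open Summit.HodgeConjecture.HodgeConjecture.Cruxes.H413.F0P3cDyRamToricCensusDefs
open Summit.HodgeConjecture.HodgeConjecture.Cruxes.H413.F0P3cDyRamDiagonalCellLetter (inv_add_map_inv_eq_map_pairing)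
open Summit.HodgeConjecture.HodgeConjecture.Cruxes.H413.F0P3cDyRamRowVertexAffineCoordinate (rayScalar_eq_affine)
open Summit.HodgeConjecture.HodgeConjecture.Cruxes.H413.F0P3cDyRamSmulXPlusLabel (labelPlus_smul_xPlus_iff_exists_norm)
open Summit.HodgeConjecture.HodgeConjecture.Cruxes.H413.F0P3cDyRamRowVertexRayDichotomy (latticeInLevel_one_endoGL_sub_one_of_v_rayScalar_le
  latticeInLevel_zero_endoGL_sub_one_of_isOrd not_latticeInLevel_one_endoGL_sub_one_of_v_rayScalar_eq_one exists_fixed_unit_valueSet_eq_smul_xPlus_of_sizes)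

variable {E M : Type} [Field E] [Valued E ℤᵐ⁰] [Field M] [Valued M ℤᵐ⁰] {ρ Θ : M →+* M} {α : M}

/-! ## HEAD — the three-way read of a terminal vertex -/

/-- **HEAD — «THE THREE-WAY READ OF A TERMINAL VERTEX».**  ★ p863048's glued-vertex frame (`E` complete, `d` even) + ★ p863845's sizes (`hYO hYb g1 g2 g3`, `jE` isometric) + the level
letters (`|u₀₀| ≤ 1`, `|u₀₀ − 1| ≤ |ϖ|`, `|μ| ≤ |ϖE|`, `|μ − ρμ| ≤ |cc(α − ρα)|·|ϖE|`, `|μ∕Y| ≤ |ϖE|`, `lam ∈ 𝒪_cc`, the population token, the three deep tokens) + ★ p862871's coordinate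
letters (`μ = jE μ_a + jE μ_b α`, `pw = ⟨w₀, w₀⟩` `σ`-fixed with `|pw·(ϖσϖ)^b| = 1`, `D₀⁻¹(jE pw)⁻¹ = κ₀ + jE(V)ξ₀`, `R₀, γ₀`) + the TERMINAL sizes `|μ_a + μ_b R₀| ≤ |ϖ|^{2b}`,
`|μ_b γ₀| = |ϖ|^{2b}` + ★ p864020's two affine clauses at `â = (μ_a + μ_b R₀)∕P`, `b̂ = μ_b γ₀∕P` (`hnx`, `haff`).  THEN, with `Γ = endoGL (γ₂, u)`:
(0) `LatticeInLevel ϖ 0 (Γ − 1) L`; (1) `¬ LatticeInLevel ϖ 1 (Γ − 1) L ↔ |α₁ + γ₁V| = 1`; (2) if `|α₁ + γ₁V| = 1` then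
`VS_{m*}(Γ − 1 | L) = valueSetMod σ ϖ m* X₊ ↔ ω(pw·(ϖσϖ)^b)·ω(α₁ + γ₁V) = 1`.
[cite: Kottwitz1986BaseChangeUnits, §1 pp. 240–241; §3] [cite: Rogawski1990, §4.9 Prop. 4.9.1 (b) p. 55] [cite: Jacobowitz1962, §4] [cite: Serre1979, Ch. III §6 Prop. 12; Ch. V §3 Cor. 3 pp. 84–86] -/
theorem level_and_label_of_terminalVertex [CompleteSpace E] {σ : E →+* E} {ϖ : E} {d t : ℕ} (hD : IsRamifiedQuadraticDatum σ ϖ d t) (hd0 : d % 2 = 0)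
    (H₂ : Matrix (Fin 2) (Fin 2) E) (h : E)
    (jE : E →+* M) (hjv : ∀ c, Valued.v (jE c) ≤ 1 ↔ Valued.v c ≤ 1) (hjiso : ∀ c, Valued.v (jE c) = Valued.v c) (hjfix : ∀ z, ρ z = z ↔ ∃ c, jE c = z)
    (hρρ : ∀ x, ρ (ρ x) = x) (hvρ : ∀ x, Valued.v (ρ x) = Valued.v x) (hα : ρ α ≠ α) (hα1 : Valued.v α ≤ 1)
    (hΘΘ : ∀ x, Θ (Θ x) = x) (hΘρ : ∀ x, Θ (ρ x) = ρ (Θ x)) (hvΘ : ∀ x, Valued.v (Θ x) = Valued.v x) (hΘj : ∀ c, Θ (jE c) = jE (σ c))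
    (φ : (Fin 2 → E) →+ M) (hφs : ∀ (c : E) (x : Fin 2 → E), φ (c • x) = jE c * φ x) (hφi : Function.Injective φ)
    {γ₂ : GL (Fin 2) E} {lam hM : M} (hφγ : ∀ x, φ ((γ₂ : Matrix (Fin 2) (Fin 2) E) *ᵥ x) = lam * φ x) (hhM : hM ≠ 0) (hΘh : Θ hM = hM)
    (hform : ∀ x y, jE (pairing σ H₂ x y) = hM * Θ (φ x) * φ y + ρ (hM * Θ (φ x) * φ y))
    {L : Submodule 𝒪[E] (Fin 3 → E)} {b : ℕ} (hb : ∀ a : E, (Pi.single 1 a : Fin 3 → E) ∈ L ↔ Valued.v a ≤ Valued.v ϖ ^ b)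
    (hpr : ∀ x ∈ L, Valued.v (x 1) * Valued.v ϖ ^ b ≤ 1)
    (hint : ∀ y ∈ L, Valued.v (pairing σ (!![H₂ 0 0, 0, H₂ 0 1; 0, h, 0; H₂ 1 0, 0, H₂ 1 1] : Matrix (Fin 3) (Fin 3) E) y y) ≤ 1)
    {B₂ : Submodule 𝒪[E] (Fin 2 → E)} {w₀ : Fin 2 → E} {g₀ : Fin 3 → E}
    (hB : B₂.map ((Matrix.toLin' (!![1, 0; 0, 0; 0, 1] : Matrix (Fin 3) (Fin 2) E)).restrictScalars 𝒪[E]) =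
      L ⊓ LinearMap.ker ((LinearMap.proj (1 : Fin 3) : (Fin 3 → E) →ₗ[E] E).restrictScalars 𝒪[E]))
    (hg₀ : g₀ ∈ L) (hg₀1 : Valued.v (g₀ 1) * Valued.v ϖ ^ b = 1) (hprg : g₀ - Pi.single 1 (g₀ 1) = ![w₀ 0, 0, w₀ 1])
    (u : GL (Fin 1) E)
    {cc x₀ : M} (hc : ρ cc = cc) (hc1 : Valued.v cc ≤ 1) (hcc : cc * (α - ρ α) ≠ 0) (hx₀ : x₀ ≠ 0)
    {Λ : AddSubgroup M} (hBΛ : B₂.toAddSubgroup.map φ = Λ)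
    (hΛx : ∀ x, x ∈ Λ ↔ ∃ ζ, IsOrd ρ α cc ζ ∧ x = x₀ * ζ) (hw₀Y : φ w₀ = (dualGen ρ Θ α cc hM x₀)⁻¹ * x₀)
    -- the cell member: integral, of level `b`; the three ray-by-trace sizes at `m*` (★ p863845)
    (hYO : IsOrd ρ α cc (dualGen ρ Θ α cc hM x₀)) (hYb : Valued.v (dualGen ρ Θ α cc hM x₀) = Valued.v (jE ϖ) ^ b)
    (g1 : Valued.v (lam - jE ((u : Matrix (Fin 1) (Fin 1) E) 0 0)) * Valued.v (jE ϖ) ^ (d - 1) ≤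
      Valued.v (α - ρ α) * Valued.v (jE ϖ) ^ b * Valued.v (jE ϖ) ^ mstarOfRecord d)
    (g2 : Valued.v (lam - jE ((u : Matrix (Fin 1) (Fin 1) E) 0 0)) * Valued.v (Θ α - α) ≤
      Valued.v (α - ρ α) * Valued.v (jE ϖ) ^ b * Valued.v (jE ϖ) ^ mstarOfRecord d)
    (g3 : Valued.v (lam - jE ((u : Matrix (Fin 1) (Fin 1) E) 0 0)) * Valued.v cc ≤
      Valued.v (α - ρ α) * Valued.v (jE ϖ) ^ b * Valued.v (jE ϖ) ^ mstarOfRecord d)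
    -- the line-model structure, the population token, the level letters
    (hΘlam : Θ lam * lam = 1) (hvlam : Valued.v lam = 1) (hlamcc : IsOrd ρ α cc lam)
    (huu : ((u : Matrix (Fin 1) (Fin 1) E) 0 0) * σ ((u : Matrix (Fin 1) (Fin 1) E) 0 0) = 1)
    (hu : Valued.v ((u : Matrix (Fin 1) (Fin 1) E) 0 0) ≤ 1) (hu1 : Valued.v ((u : Matrix (Fin 1) (Fin 1) E) 0 0 - 1) ≤ Valued.v ϖ)
    (hP : IsOrd ρ α cc ((lam - jE ((u : Matrix (Fin 1) (Fin 1) E) 0 0)) / dualGen ρ Θ α cc hM x₀))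
    (hμ1 : Valued.v (lam - jE ((u : Matrix (Fin 1) (Fin 1) E) 0 0)) ≤ Valued.v (jE ϖ))
    (hanti1 : Valued.v ((lam - jE ((u : Matrix (Fin 1) (Fin 1) E) 0 0)) - ρ (lam - jE ((u : Matrix (Fin 1) (Fin 1) E) 0 0))) ≤
      Valued.v (cc * (α - ρ α)) * Valued.v (jE ϖ))
    (hμY1 : Valued.v ((lam - jE ((u : Matrix (Fin 1) (Fin 1) E) 0 0)) / dualGen ρ Θ α cc hM x₀) ≤ Valued.v (jE ϖ))
    -- the three deep tokens
    {n : ℕ} (hn : 3 * d - 2 + d % 2 ≤ n)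
    (hlamn : Valued.v (lam - 1) ≤ Valued.v (jE ϖ) ^ n) (hun : Valued.v ((u : Matrix (Fin 1) (Fin 1) E) 0 0 - 1) ≤ Valued.v ϖ ^ n)
    (hsk : Valued.v ((lam - jE ((u : Matrix (Fin 1) (Fin 1) E) 0 0)) / dualGen ρ Θ α cc hM x₀) * Valued.v (lam - ρ lam) ≤
      Valued.v (jE ϖ) ^ n * Valued.v (cc * (α - ρ α)))
    -- the `E`-decomposition of the depth multiplier, the glue scalar, the coordinate of the vertex
    {μa μb : E} (hμab : lam - jE ((u : Matrix (Fin 1) (Fin 1) E) 0 0) = jE μa + jE μb * α)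
    (hσpw : σ (pairing σ H₂ w₀ w₀) = pairing σ H₂ w₀ w₀) (hpwv : Valued.v (pairing σ H₂ w₀ w₀ * (ϖ * σ ϖ) ^ b) = 1)
    {κ₀ ξ₀ : M} (hξ : ρ ξ₀ = -ξ₀) {V : E} (hσV : σ V = V) (hV1 : Valued.v V ≤ 1)
    (hκ : (cc * (α - ρ α) * Θ (dualGen ρ Θ α cc hM x₀))⁻¹ * (jE (pairing σ H₂ w₀ w₀))⁻¹ = κ₀ + jE V * ξ₀)
    {R₀ γ₀ : E} (hR₀ : jE R₀ = α * κ₀ + ρ (α * κ₀)) (hγ₀ : jE γ₀ = ξ₀ * (α - ρ α))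
    -- the TERMINAL sizes (`g = 0`)
    (hâ : Valued.v (μa + μb * R₀) ≤ Valued.v ϖ ^ (2 * b)) (hbh : Valued.v (μb * γ₀) = Valued.v ϖ ^ (2 * b))
    -- ★ p864020's two affine clauses at `â := (μ_a + μ_b R₀)∕P`, `b̂ := μ_b γ₀∕P`
    {α₁ γ₁ : E}
    (hnx : ∀ W : E, σ W = W → Valued.v W ≤ 1 →
      (Valued.v ((μa + μb * R₀) * ((ϖ * σ ϖ) ^ b)⁻¹ + μb * γ₀ * ((ϖ * σ ϖ) ^ b)⁻¹ * W) = 1 ↔ Valued.v (α₁ + γ₁ * W) = 1))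
    (haff : ∀ (T W f : E), σ T = T → Valued.v T = 1 → σ W = W → Valued.v W ≤ 1 → σ f = f → Valued.v (α₁ + γ₁ * W) = 1 →
      Valued.v (T * ((μa + μb * R₀) * ((ϖ * σ ϖ) ^ b)⁻¹ + μb * γ₀ * ((ϖ * σ ϖ) ^ b)⁻¹ * W) - f * ((ϖ - σ ϖ) * ((ϖ * σ ϖ) ^ ((d - d % 2) / 2))⁻¹)) ≤
        Valued.v ϖ ^ mstarOfRecord d → normSign σ f = normSign σ T * normSign σ (α₁ + γ₁ * W)) :
    LatticeInLevel ϖ 0 ((((endoGL (γ₂, u) : GL (Fin 3) E) : Matrix (Fin 3) (Fin 3) E) - 1)) L ∧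
      (¬ LatticeInLevel ϖ 1 ((((endoGL (γ₂, u) : GL (Fin 3) E) : Matrix (Fin 3) (Fin 3) E) - 1)) L ↔ Valued.v (α₁ + γ₁ * V) = 1) ∧
      (Valued.v (α₁ + γ₁ * V) = 1 →
        ({z : E | ∃ y ∈ L, Valued.v ((ϖ ^ mstarOfRecord d)⁻¹ * (z - pairing σ (!![H₂ 0 0, 0, H₂ 0 1; 0, h, 0; H₂ 1 0, 0, H₂ 1 1] : Matrix (Fin 3) (Fin 3) E) y
            ((((endoGL (γ₂, u) : GL (Fin 3) E) : Matrix (Fin 3) (Fin 3) E) - 1) *ᵥ y))) ≤ 1} =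
          valueSetMod σ ϖ (mstarOfRecord d) (xPlus σ ϖ d) ↔
        normSign σ (pairing σ H₂ w₀ w₀ * (ϖ * σ ϖ) ^ b) * normSign σ (α₁ + γ₁ * V) = 1)) := by
  classical
  obtain ⟨hσσ, hvσ, hϖ, -, hd, hd1, -⟩ := id hD
  haveI := isAdicComplete_valuedInteger_of_completeSpace (K := E) hϖ
  have hvϖ0 : Valued.v ϖ ≠ 0 := by rw [hϖ]; exact exp_ne_zero
  have hϖ0 : ϖ ≠ 0 := fun h0 => by rw [h0, map_zero] at hvϖ0; exact hvϖ0 rfl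
  have hϖlt : Valued.v ϖ < 1 := by rw [hϖ, ← exp_zero, exp_lt_exp]; norm_num
  have hρj : ∀ c : E, ρ (jE c) = jE c := fun c => (hjfix _).2 ⟨c, rfl⟩
  set D₀ : M := cc * (α - ρ α) * Θ (dualGen ρ Θ α cc hM x₀) with hD₀def
  set pw : E := pairing σ H₂ w₀ w₀ with hpwdef
  set P : E := (ϖ * σ ϖ) ^ b with hPdef
  set tp : E := (ϖ - σ ϖ) * ((ϖ * σ ϖ) ^ ((d - d % 2) / 2))⁻¹ with htpdef
  -- the glue letter and the ray scalar `e₀ = pw·(μ_a + μ_b(R₀ + Vγ₀)) = (pw·P)·(â + b̂·V)`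
  have hTr : D₀⁻¹ + ρ D₀⁻¹ = jE pw := inv_add_map_inv_eq_map_pairing σ H₂ jE hΘΘ φ hhM hform hcc hx₀ hw₀Y
  have hP0 : P ≠ 0 := pow_ne_zero _ (mul_ne_zero hϖ0 ((map_ne_zero σ).2 hϖ0))
  have hPv : Valued.v P = Valued.v ϖ ^ (2 * b) := by rw [hPdef, Valuation.map_pow, Valuation.map_mul, hvσ, ← pow_two, ← pow_mul, mul_comm]
  have hpw0 : pw ≠ 0 := fun h0 => by rw [h0, zero_mul, Valuation.map_zero] at hpwv; exact zero_ne_one hpwv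
  set e₀ : E := pw * (μa + μb * (R₀ + V * γ₀)) with he₀def
  have he₀ : jE e₀ = (lam - jE ((u : Matrix (Fin 1) (Fin 1) E) 0 0)) / D₀ + ρ ((lam - jE ((u : Matrix (Fin 1) (Fin 1) E) 0 0)) / D₀) := by
    rw [hμab, he₀def]; exact (rayScalar_eq_affine (α := α) jE hρj hρρ hTr hpw0 hξ (by rw [hρj]) hκ hR₀ hγ₀ μa μb).symm
  have he₀fac : e₀ = pw * P * ((μa + μb * R₀) * P⁻¹ + μb * γ₀ * P⁻¹ * V) := by rw [he₀def]; field_simp; ring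
  have hσT : σ (pw * P) = pw * P := by rw [map_mul, hσpw, hPdef, map_pow, map_mul, hσσ, mul_comm (σ ϖ) ϖ]
  -- `|e₀| = |â + b̂V|`
  have he₀v : Valued.v e₀ = Valued.v ((μa + μb * R₀) * P⁻¹ + μb * γ₀ * P⁻¹ * V) := by
    rw [he₀fac, Valuation.map_mul, hpwv, one_mul]
  have hab1 : Valued.v ((μa + μb * R₀) * P⁻¹ + μb * γ₀ * P⁻¹ * V) ≤ 1 := by
    have hPpos : (0 : ℤᵐ⁰) < Valued.v P := zero_lt_iff.2 ((Valuation.ne_zero_iff _).2 hP0)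
    refine (Valuation.map_add _ _ _).trans (max_le ?_ ?_)
    · rw [Valuation.map_mul, map_inv₀, hPv, ← div_eq_mul_inv, div_le_one₀ (by rw [← hPv]; exact hPpos)]; exact hâ
    · rw [Valuation.map_mul, Valuation.map_mul, map_inv₀, hbh, ← hPv, mul_inv_cancel₀ ((Valuation.ne_zero_iff _).2 hP0), one_mul]; exact hV1
  -- (0) level `0`
  have hL0 : LatticeInLevel ϖ 0 ((((endoGL (γ₂, u) : GL (Fin 3) E) : Matrix (Fin 3) (Fin 3) E) - 1)) L :=
    latticeInLevel_zero_endoGL_sub_one_of_isOrd hvρ hϖ jE φ hφs hφi hφγ hhM hb hpr hB hg₀ hg₀1 hprg hBΛ hcc hx₀ hΛx hw₀Y u hu hlamcc hP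
  -- (1) the level-`1` dichotomy by `|e₀|`
  have hL1 : ¬ LatticeInLevel ϖ 1 ((((endoGL (γ₂, u) : GL (Fin 3) E) : Matrix (Fin 3) (Fin 3) E) - 1)) L ↔ Valued.v (α₁ + γ₁ * V) = 1 := by
    constructor
    · intro hnot
      by_contra hne
      -- `|e₀| < 1`, hence `≤ |ϖ|`, hence level `1`
      have hlt : Valued.v e₀ < 1 := by
        rw [he₀v]; exact lt_of_le_of_ne hab1 (fun h1 => hne ((hnx V hσV hV1).1 h1))
      exact hnot (latticeInLevel_one_endoGL_sub_one_of_v_rayScalar_le hρρ hvρ hΘΘ hΘρ hvΘ hϖ jE hjv hjfix φ hφs hφi hφγ hhM hΘh hb hpr hB hg₀ hg₀1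
        hprg hBΛ hc hcc hx₀ hΛx hw₀Y u hu1 hμ1 hanti1 hμY1 he₀ (v_le_uniformizer_of_lt_one hϖ hlt))
    · intro hNX
      have he₀1 : Valued.v e₀ = 1 := by rw [he₀v]; exact (hnx V hσV hV1).2 hNX
      exact not_latticeInLevel_one_endoGL_sub_one_of_v_rayScalar_eq_one hρρ hvρ hΘΘ hΘρ hvΘ hϖ jE hjv hjfix φ hφs hφi hφγ hhM hΘh hb hpr hB hg₀ hg₀1 hprg
        hBΛ hc hcc hx₀ hΛx hw₀Y u he₀ he₀1
  refine ⟨hL0, hL1, fun hNX => ?_⟩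
  -- (2) under `NX`: `|e₀| = 1 = |ϖ|^{d%2}`, ★ p863845 HEAD, ★ the bit of a fixed-unit ray, ★ p864020 clause (ii)
  have he₀1 : Valued.v e₀ = Valued.v ϖ ^ (d % 2) := by rw [hd0, pow_zero, he₀v]; exact (hnx V hσV hV1).2 hNX
  obtain ⟨e', he'σ, he'1, hclose, hVS⟩ := exists_fixed_unit_valueSet_eq_smul_xPlus_of_sizes hD H₂ h jE hjv hjiso hjfix hρρ hvρ hα hα1 hΘΘ hΘρ hvΘ hΘj φ hφs
    hφγ hhM hΘh hform hpr hint hB hg₀ hg₀1 hprg u hc hc1 hcc hx₀ hBΛ hΛx hw₀Y hYO hYb g1 g2 g3 hΘlam hvlam huu hP he₀ he₀1 hn hlamn hun hsk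
  rw [hVS]
  have hbit : valueSetMod σ ϖ (mstarOfRecord d) (e' • xPlus σ ϖ d) = valueSetMod σ ϖ (mstarOfRecord d) (xPlus σ ϖ d) ↔ ∃ z : E, z * σ z = e' :=
    labelPlus_smul_xPlus_iff_exists_norm hD he'σ he'1
  rw [hbit]
  have hcong : Valued.v (pw * P * ((μa + μb * R₀) * P⁻¹ + μb * γ₀ * P⁻¹ * V) - e' * tp) ≤ Valued.v ϖ ^ mstarOfRecord d := by
    rw [← he₀fac]; exact hclose
  have hns := haff (pw * P) V e' hσT hpwv hσV hV1 he'σ hNX hcong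
  constructor
  · intro hz
    have h1 : normSign σ e' = 1 := by rw [normSign, if_pos hz]
    rw [← h1, hns]
  · intro h1
    rw [← hns] at h1
    by_contra hz
    rw [normSign, if_neg hz] at h1
    exact absurd h1 (by norm_num)

end Summit.HodgeConjecture.HodgeConjecture.Cruxes.H413.F0P3cDyRamTerminalVertexRead

end
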